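import Literature.Analysis.FluidPDE.NSLerayHopf
import HarnessLib

/-! # Density from syndetic phases (pure real analysis) — decomp-ad lens-3 g58, BC5 rung for `DutyCycle.ReturnsHaveDensity`

Part 1 of 2 of the landable rung file `DutyCycleReturnsHaveDensityRung.lean` (lens-3 g58, sha256 fae842a117b3c721;
split only to respect the ≤ 400-line rule; statement bytes untouched). If good `τ`-phases start within every window of
length `G` after any `t₀ ≥ 0` (a SYNDETIC family of phase starts) and `R` holds for a.e. `t > 0`, the set
`{t ∈ [0,T] | R t ∧ Q t}` has Lebesgue measure `≥ τ/(2(G+τ))·T` for arbitrarily large `T` (greedy disjoint phases,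
null bad set). This is exactly the registered stub `stub_densityFromSyndeticPhases` of item
stmt-AnomalousDissipation-27340 (proved by name in part 2, `DutyCycleReturnsHaveDensityRung.lean`). [folklore] -/

noncomputable section

-- `Summit.<Summit>.<Problem>` is the tree's mandated summit-side namespace (CONVENTIONS §2); for this
-- single-conjunct summit the two segments coincide, so the duplicate is deliberate.
set_option linter.dupNamespace false

open MeasureTheory Set Filter
open scoped RealInnerProductSpace
open Literature.Analysis Literature.Analysis.FluidPDE Literature.Analysis.FluidPDE.Torus

namespace Summit.AnomalousDissipation.AnomalousDissipation.Theorems.DutyCycle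

/-! ### §1 Density from syndetic phases -/

/-- **Density from syndetic phases** (pure real analysis): if good `τ`-phases (on which `Q` holds) start within
every window of length `G` after any `t₀ ≥ 0`, and `R` holds for a.e. `t > 0`, then for arbitrarily large `T` the set
`{t ∈ [0,T] | R t ∧ Q t}` has Lebesgue measure `≥ τ/(2(G+τ)) · T` (greedy disjoint phases; the bad set of `R` is null). -/
theorem densityFromSyndeticPhases : ∀ (Q R : ℝ → Prop) (τ G : ℝ), 0 < τ → 0 < G → (∀ᵐ t : ℝ, 0 < t → R t) → (∀ t₀ : ℝ, 0 ≤ t₀ → ∃ t : ℝ, t₀ ≤ t ∧ t ≤ t₀ + G ∧ ∀ s : ℝ, t ≤ s → s ≤ t + τ → Q s) → ∀ T₀ : ℝ, ∃ T : ℝ, T₀ ≤ T ∧ τ / (2 * (G + τ)) * T ≤ (MeasureTheory.volume {t : ℝ | t ∈ Set.Icc 0 T ∧ R t ∧ Q t}).toReal := by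
  intro Q R τ G hτ hG hR h T₀
  -- a total "next phase" selector
  have h' : ∀ x : ℝ, ∃ t : ℝ, max x 0 ≤ t ∧ t ≤ max x 0 + G ∧ ∀ s : ℝ, t ≤ s → s ≤ t + τ → Q s :=
    fun x => h (max x 0) (le_max_right _ _)
  choose next hnext using h'
  -- the greedy sequence of phase starts
  let t : ℕ → ℝ := fun k => Nat.rec (next 0) (fun _ tk => next (tk + τ)) k
  have ht0 : t 0 = next 0 := rfl
  have htsucc : ∀ k, t (k + 1) = next (t k + τ) := fun k => rfl
  have hnn : ∀ k, 0 ≤ t k := by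
    intro k
    cases k with
    | zero => rw [ht0]; exact (le_max_right _ _).trans (hnext 0).1
    | succ k => rw [htsucc]; exact (le_max_right _ _).trans (hnext _).1
  have hstep : ∀ k, t k + τ ≤ t (k + 1) := fun k => by
    rw [htsucc]; exact (le_max_left _ _).trans (hnext _).1
  have hGτ : 0 < G + τ := by linarith
  have hup : ∀ k : ℕ, t k + τ ≤ ((k : ℝ) + 1) * (G + τ) := by
    intro k
    induction k with
    | zero =>
      rw [ht0]
      have h1 := (hnext 0).2.1
      rw [max_self] at h1
      push_cast
      linarith
    | succ k ih =>
      rw [htsucc]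
      have h1 := (hnext (t k + τ)).2.1
      have hm : max (t k + τ) 0 = t k + τ := max_eq_left (by linarith [hnn k])
      rw [hm] at h1
      push_cast
      nlinarith
  have hQ : ∀ k s, t k ≤ s → s ≤ t k + τ → Q s := by
    intro k s hs1 hs2
    cases k with
    | zero => rw [ht0] at hs1 hs2; exact (hnext 0).2.2 s hs1 hs2
    | succ k => rw [htsucc] at hs1 hs2; exact (hnext _).2.2 s hs1 hs2
  have hsep : ∀ k l : ℕ, k < l → t k + τ ≤ t l := by
    intro k l hkl
    induction l with
    | zero => exact absurd hkl (Nat.not_lt_zero _)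
    | succ l ih =>
      rcases Nat.lt_succ_iff_lt_or_eq.1 hkl with hlt | heq
      · have := ih hlt
        linarith [hstep l]
      · subst heq
        exact hstep k
  -- the number of phases and the horizon
  obtain ⟨m, hm⟩ : ∃ m : ℕ, T₀ / (G + τ) ≤ m := exists_nat_ge _
  refine ⟨(m : ℝ) * (G + τ), ?_, ?_⟩
  · have := (div_le_iff₀ hGτ).1 hm
    linarith
  · set S : Set ℝ := {x : ℝ | x ∈ Set.Icc 0 ((m : ℝ) * (G + τ)) ∧ R x ∧ Q x} with hS
    set U : Set ℝ := ⋃ k ∈ Finset.range m, Ico (t k) (t k + τ) with hU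
    have hdisj : (↑(Finset.range m) : Set ℕ).PairwiseDisjoint (fun k => Ico (t k) (t k + τ)) := by
      intro k _ l _ hkl
      change Disjoint (Ico (t k) (t k + τ)) (Ico (t l) (t l + τ))
      rcases lt_or_gt_of_ne hkl with h1 | h1
      · exact Set.disjoint_left.2 fun x hxk hxl => by
          have := hsep k l h1
          linarith [hxk.2, hxl.1]
      · exact Set.disjoint_left.2 fun x hxk hxl => by
          have := hsep l k h1
          linarith [hxl.2, hxk.1]
    have hUmeas : volume U = (m : ENNReal) * ENNReal.ofReal τ := by
      rw [hU, measure_biUnion_finset hdisj (fun k _ => measurableSet_Ico)]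
      simp [Real.volume_Ico, Finset.sum_const, Finset.card_range]
    -- the null set where `R` fails at a positive time, plus `{0}`
    set N : Set ℝ := {x : ℝ | ¬ (0 < x → R x)} ∪ {0} with hN
    have hNnull : volume N = 0 := measure_union_null (ae_iff.1 hR) (measure_singleton 0)
    have hsub : U \ N ⊆ S := by
      rintro x ⟨hxU, hxN⟩
      rw [hU, Set.mem_iUnion₂] at hxU
      obtain ⟨k, hk, hx⟩ := hxU
      have hk' : k < m := Finset.mem_range.1 hk
      simp only [hN, Set.mem_union, Set.mem_setOf_eq, Set.mem_singleton_iff, not_or, not_not] at hxN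
      have hx0 : 0 ≤ x := (hnn k).trans hx.1
      have hxpos : 0 < x := lt_of_le_of_ne hx0 (Ne.symm hxN.2)
      refine ⟨⟨hx0, ?_⟩, hxN.1 hxpos, hQ k x hx.1 hx.2.le⟩
      have h1 := hup k
      have h2 : ((k : ℝ) + 1) * (G + τ) ≤ (m : ℝ) * (G + τ) := by
        have : (k : ℝ) + 1 ≤ m := by exact_mod_cast hk'
        exact mul_le_mul_of_nonneg_right this hGτ.le
      linarith [hx.2]
    have hfin : volume S ≠ ⊤ := by
      refine ne_top_of_le_ne_top (measure_Icc_lt_top (μ := volume) (a := (0:ℝ)) (b := (m : ℝ) * (G + τ))).ne ?_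
      exact measure_mono fun x hx => hx.1
    have hle : volume U ≤ volume S := by
      calc volume U = volume (U \ N) := (measure_sdiff_null hNnull).symm
        _ ≤ volume S := measure_mono hsub
    have hUreal : (volume U).toReal = m * τ := by
      rw [hUmeas, ENNReal.toReal_mul, ENNReal.toReal_natCast, ENNReal.toReal_ofReal hτ.le]
    have hmτ : (0 : ℝ) ≤ m * τ := by positivity
    calc τ / (2 * (G + τ)) * ((m : ℝ) * (G + τ)) = m * τ / 2 := by
          field_simp
      _ ≤ m * τ := by linarith
      _ = (volume U).toReal := hUreal.symm
      _ ≤ (volume S).toReal := ENNReal.toReal_mono hfin hle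

/-! ### Registered-stub alias (skeleton of item 27340: `stub_densityFromSyndeticPhases`, by name + signature) -/

/-- registered stub `stub_densityFromSyndeticPhases` of crux `DutyCycle.ReturnsHaveDensity` — PROVED. -/
theorem stub_densityFromSyndeticPhases : ∀ (Q R : ℝ → Prop) (τ G : ℝ), 0 < τ → 0 < G → (∀ᵐ t : ℝ, 0 < t → R t) → (∀ t₀ : ℝ, 0 ≤ t₀ → ∃ t : ℝ, t₀ ≤ t ∧ t ≤ t₀ + G ∧ ∀ s : ℝ, t ≤ s → s ≤ t + τ → Q s) → ∀ T₀ : ℝ, ∃ T : ℝ, T₀ ≤ T ∧ τ / (2 * (G + τ)) * T ≤ (MeasureTheory.volume {t : ℝ | t ∈ Set.Icc 0 T ∧ R t ∧ Q t}).toReal :=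
  densityFromSyndeticPhases

end Summit.AnomalousDissipation.AnomalousDissipation.Theorems.DutyCycle

end
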